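import Summits.FinalStateConjecture.FinalStateConjecture.Theses.PhotonSphereChannels
import Summits.FinalStateConjecture.FinalStateConjecture.Theorems.PhotonSphereChannelsExteriorEnergyRW
import Summits.FinalStateConjecture.FinalStateConjecture.Theorems.WindowedShellChannels.Negative.InfiniteEnergy

/-!
# Crux `WindowedShellChannels` (stmt-FinalStateConjecture-14085), line `SketchIdeator3` — stub `stub_finiteEnergy`

Reduction to finite-energy solutions (infinite energy forces the lagged forward channel energy to `⊤`).
-/

noncomputable section

set_option linter.dupNamespace false

namespace Summit.FinalStateConjecture.FinalStateConjecture.Theorems.WindowedShellChannelsStubs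

open Literature.Geometry.Lorentzian Literature.Geometry.Lorentzian.ReggeWheeler
open Summit.FinalStateConjecture.FinalStateConjecture.Theses.PhotonSphereChannels
open Filter Set MeasureTheory
open scoped ENNReal Topology

/-- REDUCTION (finite energy): an infinite-energy solution has forward lagged channel energy `⊤`
(`Theorems.WindowedShellChannels.Negative.channelEnergy_eq_top_of_totalEnergy_eq_top`), so the inequality is free
there and the same `(h, c)` work. -/
theorem stub_finiteEnergy (σ : ℝ)
    (H : ∀ M : ℝ, 0 < M → ∀ ρ : ℝ, 0 < ρ → ∃ h : ℝ, 0 ≤ h ∧ ∃ c : ℝ, 0 < c ∧ ∀ (r : ℝ → ℝ) (xc : ℝ),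
        IsTortoiseRadius M r xc → ∀ (s ℓ : ℕ), s ≤ 2 → s ≤ ℓ → ∀ ψ : ℝ → ℝ → ℝ,
          IsRWSolution M s ℓ r ψ → (∀ t x, ψ (-t) x = σ * ψ t x) →
          CauchyDataSupportedOn ψ {x : ℝ | ρ < |x - xc|} →
          totalEnergy (linePotential M s ℓ r) ψ 0 ≠ ⊤ →
            ENNReal.ofReal c * totalEnergy (linePotential M s ℓ r) ψ 0 ≤
              channelEnergy (linePotential M s ℓ r) xc (ρ - h) ψ atTop) :
    ∀ M : ℝ, 0 < M → ∀ ρ : ℝ, 0 < ρ → ∃ h : ℝ, 0 ≤ h ∧ ∃ c : ℝ, 0 < c ∧ ∀ (r : ℝ → ℝ) (xc : ℝ),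
      IsTortoiseRadius M r xc → ∀ (s ℓ : ℕ), s ≤ 2 → s ≤ ℓ → ∀ ψ : ℝ → ℝ → ℝ,
        IsRWSolution M s ℓ r ψ → (∀ t x, ψ (-t) x = σ * ψ t x) →
        CauchyDataSupportedOn ψ {x : ℝ | ρ < |x - xc|} →
          ENNReal.ofReal c * totalEnergy (linePotential M s ℓ r) ψ 0 ≤
            channelEnergy (linePotential M s ℓ r) xc (ρ - h) ψ atTop := by
  intro M hM ρ hρ
  obtain ⟨h, hh, c, hc, H'⟩ := H M hM ρ hρ
  refine ⟨h, hh, c, hc, ?_⟩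
  intro r xc hr s ℓ hs hsℓ ψ hψ hpar hsupp
  by_cases hE : totalEnergy (linePotential M s ℓ r) ψ 0 = ⊤
  · obtain ⟨h1, -⟩ :=
      WindowedShellChannels.Negative.channelEnergy_eq_top_of_totalEnergy_eq_top
        (RW.differentiable_linePotential hr s ℓ) (fun x => (RW.linePotential_pos hr hsℓ x).le)
        hψ xc (ρ - h) hE
    rw [h1]
    exact le_top
  · exact H' r xc hr s ℓ hs hsℓ ψ hψ hpar hsupp hE

end Summit.FinalStateConjecture.FinalStateConjecture.Theorems.WindowedShellChannelsStubs

end
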